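import Summits.CriticalPhenomena.PercolationContinuityZ3.Theorems.Transplant.FKConnectivityAllQPat3KNetPlaceVee
import HarnessLib

/-!
# Connectivity correlation inequalities for `φ_{w,q}`, every `q > 0` — THEOREM SP(𝒦): reducing a mark-free slot of a `K₄` to a plain edge

Helper file (`--supports stmt-CriticalPhenomena-4575`), census lineage (gen 41) of LANE 2's FK sub-programme; builds on p205010 (kernel
theorem, internal audit signed; external expert review pending).  No definitions, no named facts, no sorries; standard axioms.

`FK.K4Sep.reduce_cd`: on a `K₄` with six 𝒦-slots and three marks off the interior of the slot `cd`, SP-goodness of the minor `(E, C)`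
follows from the case where `Qcd` IS the single edge `cd` and that edge lies in `E ∪ C` — the other cases being the SHRINK
(«Pat3KNetPlaceSteps» `spGoodC_of_shrink` via `K4Sep.shrink_ab` relabeled) and the ERASE (`spGoodC_of_erase`, the `K₄` minus `cd` being a
bridge on `c, d`) steps, both through the outer induction hypothesis.  Other slots: relabel the `K4Sep` at the call site
(`swap_ab / swap_cd / swap_bc / swap_ac`).  Also `FK.injective_vec7` (names for the t = 3 leaves).
[cite: AyyerLinussonRavichandran2025, §7 (p. 22)]
-/

namespace Summit.CriticalPhenomena.PercolationContinuityZ3.Theorems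

namespace FK

open scoped Classical

variable {V : Type*}

/-- Seven pairwise distinct vertices are injective names `Fin 7 → V`. [folklore] -/
theorem injective_vec7 {a b c d s t u : V} (hab : a ≠ b) (hac : a ≠ c) (had : a ≠ d) (has : a ≠ s) (hat : a ≠ t) (hau : a ≠ u)
    (hbc : b ≠ c) (hbd : b ≠ d) (hbs : b ≠ s) (hbt : b ≠ t) (hbu : b ≠ u) (hcd : c ≠ d) (hcs : c ≠ s) (hct : c ≠ t) (hcu : c ≠ u)
    (hds : d ≠ s) (hdt : d ≠ t) (hdu : d ≠ u) (hst : s ≠ t) (hsu : s ≠ u) (htu : t ≠ u) :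
    Function.Injective ![a, b, c, d, s, t, u] := by
  intro i j h
  fin_cases i <;> fin_cases j <;> simp at h <;>
    first | rfl | exact absurd h ‹_› | exact absurd h.symm ‹_›

section Reduce

variable [Fintype V] {N₀ : Finset (Sym2 V)} {Qab Qac Qad Qbc Qbd Qcd : Finset (Sym2 V)} {a b c d m₁ m₂ m₃ : V}

/-- **REDUCING THE SLOT `cd` TO A PLAIN EDGE IN `E ∪ C`** (census g41). [cite: AyyerLinussonRavichandran2025, §7 (p. 22)] -/
theorem K4Sep.reduce_cd
    (ihSP : ∀ {N' E' C' : Finset (Sym2 V)} {x' y' b' s' t' : V}, N'.card < N₀.card → IsKNet N' x' y' → E' ⊆ N' → C' ⊆ N' →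
      (∃ e ∈ N', b' ∈ e) → (∃ e ∈ N', s' ∈ e) → (∃ e ∈ N', t' ∈ e) → b' ≠ s' → b' ≠ t' → s' ≠ t' → SPGoodC E' C' b' s' t')
    (h : K4Sep Qab Qac Qad Qbc Qbd Qcd a b c d) (hab : IsKNet Qab a b) (hac : IsKNet Qac a c) (had : IsKNet Qad a d)
    (hbc : IsKNet Qbc b c) (hbd : IsKNet Qbd b d) (hcd : IsKNet Qcd c d)
    (hN : Qab ∪ (Qac ∪ Qad ∪ Qbc ∪ Qbd ∪ Qcd) ⊆ N₀)
    (hm₁ : ∃ e ∈ Qab ∪ (Qac ∪ Qad ∪ Qbc ∪ Qbd), m₁ ∈ e) (hm₂ : ∃ e ∈ Qab ∪ (Qac ∪ Qad ∪ Qbc ∪ Qbd), m₂ ∈ e)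
    (hm₃ : ∃ e ∈ Qab ∪ (Qac ∪ Qad ∪ Qbc ∪ Qbd), m₃ ∈ e)
    (h₁ : (∃ e ∈ Qcd, m₁ ∈ e) → m₁ = c ∨ m₁ = d) (h₂' : (∃ e ∈ Qcd, m₂ ∈ e) → m₂ = c ∨ m₂ = d)
    (h₃ : (∃ e ∈ Qcd, m₃ ∈ e) → m₃ = c ∨ m₃ = d) (d12 : m₁ ≠ m₂) (d13 : m₁ ≠ m₃) (d23 : m₂ ≠ m₃)
    {E C : Finset (Sym2 V)} (hE : E ⊆ Qab ∪ (Qac ∪ Qad ∪ Qbc ∪ Qbd ∪ Qcd)) (hC : C ⊆ Qab ∪ (Qac ∪ Qad ∪ Qbc ∪ Qbd ∪ Qcd))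
    (hcont : Qcd = {s(c, d)} → (s(c, d) ∈ E ∨ s(c, d) ∈ C) → SPGoodC E C m₁ m₂ m₃) : SPGoodC E C m₁ m₂ m₃ := by
  have lift : ∀ {m : V}, (∃ e ∈ Qab ∪ (Qac ∪ Qad ∪ Qbc ∪ Qbd), m ∈ e) → ∃ e ∈ Qab ∪ (Qac ∪ Qad ∪ Qbc ∪ Qbd ∪ Qcd), m ∈ e := by
    rintro m ⟨e, he, hme⟩
    refine ⟨e, ?_, hme⟩
    simp only [Finset.mem_union] at he ⊢
    rcases he with he | ((he | he) | he) | he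
    exacts [Or.inl he, Or.inr (Or.inl (Or.inl (Or.inl (Or.inl he)))), Or.inr (Or.inl (Or.inl (Or.inl (Or.inr he)))),
      Or.inr (Or.inl (Or.inl (Or.inr he))), Or.inr (Or.inl (Or.inr he))]
  -- shrink
  by_cases h2 : 2 ≤ Qcd.card
  · have eN : Qab ∪ (Qac ∪ Qad ∪ Qbc ∪ Qbd ∪ Qcd) = Qcd ∪ (Qbc ∪ Qac ∪ Qbd ∪ Qad ∪ Qab) := by ac_rfl
    have hm₁' := lift hm₁; have hm₂' := lift hm₂; have hm₃' := lift hm₃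
    rw [eN] at hN hE hC hm₁' hm₂' hm₃'
    exact K4Sep.spGoodC_shrink_ab ihSP h.swap_ac.swap_cd.swap_bc hcd hbc.symm hac.symm hbd.symm had.symm hab.symm h2 hN
      hm₁' hm₂' hm₃' h₁ h₂' h₃ d12 d13 d23 hE hC
  -- single edge
  obtain rfl : Qcd = {s(c, d)} := hcd.eq_singleton_of_card_le_one (by omega)
  by_cases x : s(c, d) ∈ E ∨ s(c, d) ∈ C
  · exact hcont rfl x
  -- erase
  have hM : IsKNet (Qbc ∪ Qac ∪ Qbd ∪ Qad ∪ Qab) c d :=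
    IsKNet.bridge hbc.symm hac.symm hbd.symm had.symm hab.symm h.swap_ac.swap_cd.swap_bc.toBridgeSep
  have eM : Qab ∪ (Qac ∪ Qad ∪ Qbc ∪ Qbd ∪ {s(c, d)}) = insert s(c, d) (Qbc ∪ Qac ∪ Qbd ∪ Qad ∪ Qab) := by
    rw [Finset.insert_eq]; ac_rfl
  have eM' : Qab ∪ (Qac ∪ Qad ∪ Qbc ∪ Qbd) = Qbc ∪ Qac ∪ Qbd ∪ Qad ∪ Qab := by ac_rfl
  have heM : s(c, d) ∉ Qbc ∪ Qac ∪ Qbd ∪ Qad ∪ Qab := by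
    intro hh
    simp only [Finset.mem_union] at hh
    rcases hh with (((e | e) | e) | e) | e
    · exact Finset.disjoint_singleton_right.1 h.d_bc_cd e
    · exact Finset.disjoint_singleton_right.1 h.d_ac_cd e
    · exact Finset.disjoint_singleton_right.1 h.d_bd_cd e
    · exact Finset.disjoint_singleton_right.1 h.d_ad_cd e
    · exact Finset.disjoint_singleton_right.1 h.d_ab_cd e
  rw [eM'] at hm₁ hm₂ hm₃
  exact spGoodC_of_erase ihSP (e := s(c, d)) (by simp) heM (by rw [eM]; exact Finset.subset_insert _ _) eM.le hM hN hm₁ hm₂ hm₃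
    d12 d13 d23 hE hC (fun hh => x (Or.inl hh)) (fun hh => x (Or.inr hh))

end Reduce

end FK

end Summit.CriticalPhenomena.PercolationContinuityZ3.Theorems
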